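import Literature.MathematicalPhysics.QuantumFieldTheory.Balaban1983to89.B1Eq324BenfattoKernelComparisonBounded
import HarnessLib

/-!
# `Balaban1983to89.B1Eq324BenfattoKernelComparisonBochner` — [BenfattoEtAl1978] §5 (5.13) p. 155 for the class of
# [Balaban1985BackgroundPropagators] Sect. E p. 428, IN THE BOCHNER (REAL-OBSERVABLE) CURRENCY: the two-sided class substitute for
# «the integral factorizes over the boxes», at temperature `±diag r` and at temperature zero, for bounded non-negative real box observables, PROVED

statement-level skeleton of published theorems with citation tags; proofs where landed; nothing here is a claim about the
Yang–Mills mass gap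

WHY THIS MODULE (cell `pub-ymgap`, width seat `dag-n08-w5`; the piece located by seat `dag-n08-d` gen 12 as «(r30) Bochner (real-valued) twins
of J4/J5-T §3 for bounded non-negative real observables»; node N08 [Balaban1985UV3]; the [BenfattoEtAl1978] source chain behind the
(α)-row `h324`).  The class substitute for print's exact Markov factorisation (5.13) p. 155 is in the tree on the `ℝ≥0∞` side:
`…KernelComparisonBoxes.lintegral_prod_restrict_condFieldK_le_exp_mul_prod` / `…exp_mul_prod_lintegral_le_lintegral_prod_restrict_condFieldK`
(temperatures `∓diag r`, constants `e^{±ρ}`, `ρ = Σ_y r_y/(γ − r_max)`) and `…KernelComparisonBounded.lintegral_prod_restrict_condFieldK_le_exp_mul_prod_dirichlet`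
/ `…exp_mul_prod_dirichlet_le_lintegral_prod_restrict_condFieldK` (temperature zero on bounded-fluctuation supports, constants `e^{±(ρ+T/2)}`).
The §5 chain of the tree is written in the Bochner currency — `…Sect5Eq515.integral_boxes_factorise_eq`, `…Sect5Eq515.integral_cutoff_exp_hatH_ge`,
`…Sect5PavementStep.pavementStep_of_setIntegral`, `…Sect5Eq536.upperPavementStep_cond_of_setIntegral` all speak of `∫`, not `∫⁻`, and their
integrands `Π_□ χ̂_□ e^{H_□}` are bounded and non-negative (the cut-offs `χ̂` make them so).  This file is the currency adapter: the same four
two-sided bounds for measurable BOUNDED non-negative real observables `0 ≤ F_p ≤ M_p` of the box fields, with real constants `e^{±ρ}` /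
`e^{±(ρ+T/2)}` and Bochner integrals on both sides.  The conversion is the routine `ofReal`/`toReal` one: every measure on the right is a
probability measure (Mathlib's `multivariateGaussian`), so a bounded observable has a finite `∫⁻`, and the finiteness of the left-hand side
under the conditioned class field `P̄^K_{Γ,z̄}` is READ OFF the upper `∫⁻` bound (no probability-measure fact about `P̄^K_{Γ,z̄}` is used).

WHAT IS PROVED (standard axioms; no `sorry`; no definition).  Setting of `…KernelComparisonBoxes` §3: the class kernel
`hK : K x y = [x,y∈Λ]·(A⁻¹)_{xy}` of a symmetric `γ`-coercive `A` on `Λ`, corridors `Γ ⊆ Λ`, a partition `π` of `↥(Λ ∖ Γ)` with boxes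
`box p = {y ∈ Λ∖Γ : π y = p}` given as `Finset`s, cross-row-sum bounds `Σ_{π y′ ≠ π y}|A_{yy′}| ≤ r_y ≤ r_max < γ`, `ρ := (Σ_y r_y)/(γ − r_max)`;
observables `F_p : (box p → ℝ) → ℝ` measurable with `0 ≤ F_p ≤ M_p`.
* §1 ★★ `integral_prod_restrict_condFieldK_le_exp_mul_prod` / `exp_mul_prod_integral_le_integral_prod_restrict_condFieldK` — THE CLASS (5.13) IN
  THE BOCHNER CURRENCY: `∫ Π_p F_p(z|_{box p}) dP̄^K_{Γ,z̄} ≤ e^{ρ} · Π_p ∫ F_p dN(u_Γ(z̄)|_{box p}, (A|_{box p} − diag(r|_{box p}))⁻¹)` and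
  `e^{−ρ} · Π_p ∫ F_p dN(u_Γ(z̄)|_{box p}, (A|_{box p} + diag(r|_{box p}))⁻¹) ≤ ∫ Π_p F_p(z|_{box p}) dP̄^K_{Γ,z̄}`.
* §2 ★★ `integral_prod_restrict_condFieldK_le_exp_mul_prod_dirichlet` / `exp_mul_prod_dirichlet_le_integral_prod_restrict_condFieldK` — THE CLASS
  (5.13) AT TEMPERATURE ZERO IN THE BOCHNER CURRENCY: if moreover `(∀ p, F_p(z|_{box p}) ≠ 0) → Σ_y r_y (z_y − u_Γ(z̄)_y)² ≤ T`, then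
  `∫ Π_p F_p(z|_{box p}) dP̄^K_{Γ,z̄} ≤ e^{ρ+T/2} · Π_p ∫ F_p dN(u_Γ(z̄)|_{box p}, (A|_{box p})⁻¹)` and
  `e^{−(ρ+T/2)} · Π_p ∫ F_p dN(u_Γ(z̄)|_{box p}, (A|_{box p})⁻¹) ≤ ∫ Π_p F_p(z|_{box p}) dP̄^K_{Γ,z̄}` — the SAME plain Dirichlet box Gaussians both ways.
HONEST SCOPE.  A currency conversion of four landed tree theorems (seats n08-d / n08-b); the class, the substitute for (5.13) and the
bounded-fluctuation device are OURS, not print; nothing of [Balaban1985UV3] / [Balaban1985UV2] is asserted; no generalised Basic Lemma is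
stated; the §5-side port is not begun here; count-neutral for N08; nothing about d = 4, the continuum, OS axioms, a mass gap or the
Clay problem.
-/

noncomputable section

open MeasureTheory ProbabilityTheory Finset Matrix WithLp
open scoped BigOperators Matrix NNReal ENNReal

namespace Literature.MathematicalPhysics.QuantumFieldTheory.Balaban1983to89.B1Eq324BenfattoKernelComparisonBochner

open Literature.MathematicalPhysics.QuantumFieldTheory
open Literature.MathematicalPhysics.QuantumFieldTheory.Balaban1983to89.B1Eq324BenfattoLemma
open Literature.MathematicalPhysics.QuantumFieldTheory.Balaban1983to89.B1Eq324BenfattoKernelRegression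
open Literature.MathematicalPhysics.QuantumFieldTheory.Balaban1983to89.B1Eq324BenfattoKernelComparisonBoxes
open Literature.MathematicalPhysics.QuantumFieldTheory.Balaban1983to89.B1Eq324BenfattoKernelComparisonBounded

variable {d : ℕ}

/-! ## §0  Conversion kernels: a two-sided `∫⁻` comparison of a product transfers to Bochner integrals -/

section Conversion

/-- kernel: an upper `∫⁻` comparison against a constant times a product of `∫⁻`s over probability measures transfers to Bochner
integrals of bounded non-negative observables. [folklore] -/
private theorem integral_le_mul_prod_integral_of_lintegral {Ω : Type*} [MeasurableSpace Ω] {μ : Measure Ω}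
    {σ : Type*} [Fintype σ] {E : σ → Type*} [∀ p, MeasurableSpace (E p)] {ν : (p : σ) → Measure (E p)}
    [∀ p, IsProbabilityMeasure (ν p)] {G : Ω → ℝ} (hG : Measurable G) (hG0 : ∀ ω, 0 ≤ G ω)
    {g : (p : σ) → E p → ℝ} (hg : ∀ p, Measurable (g p)) (hg0 : ∀ p x, 0 ≤ g p x) {M : σ → ℝ}
    (hgM : ∀ p x, g p x ≤ M p) {c : ℝ} (hc : 0 ≤ c)
    (h : ∫⁻ ω, ENNReal.ofReal (G ω) ∂μ ≤ ENNReal.ofReal c * ∏ p, ∫⁻ x, ENNReal.ofReal (g p x) ∂ν p) :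
    ∫ ω, G ω ∂μ ≤ c * ∏ p, ∫ x, g p x ∂ν p := by
  have hfin : ∀ p, ∫⁻ x, ENNReal.ofReal (g p x) ∂ν p ≠ ∞ := fun p => by
    refine ne_top_of_le_ne_top (ENNReal.ofReal_ne_top (r := M p)) ?_
    calc ∫⁻ x, ENNReal.ofReal (g p x) ∂ν p ≤ ∫⁻ _, ENNReal.ofReal (M p) ∂ν p :=
          lintegral_mono fun x => ENNReal.ofReal_le_ofReal (hgM p x)
      _ = ENNReal.ofReal (M p) := by rw [lintegral_const, measure_univ, mul_one]
  have hR : ENNReal.ofReal c * ∏ p, ∫⁻ x, ENNReal.ofReal (g p x) ∂ν p ≠ ∞ :=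
    ENNReal.mul_ne_top ENNReal.ofReal_ne_top (ENNReal.prod_ne_top fun p _ => hfin p)
  have hrhs : c * ∏ p, ∫ x, g p x ∂ν p =
      (ENNReal.ofReal c * ∏ p, ∫⁻ x, ENNReal.ofReal (g p x) ∂ν p).toReal := by
    rw [ENNReal.toReal_mul, ENNReal.toReal_ofReal hc, ENNReal.toReal_prod]
    congr 1
    exact Finset.prod_congr rfl fun p _ =>
      integral_eq_lintegral_of_nonneg_ae (Filter.Eventually.of_forall (hg0 p)) (hg p).aestronglyMeasurable
  rw [integral_eq_lintegral_of_nonneg_ae (Filter.Eventually.of_forall hG0) hG.aestronglyMeasurable, hrhs]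
  exact ENNReal.toReal_mono hR h

/-- kernel: a lower `∫⁻` comparison of a constant times a product of `∫⁻`s against a FINITE `∫⁻` transfers to Bochner integrals of
non-negative observables. [folklore] -/
private theorem mul_prod_integral_le_integral_of_lintegral {Ω : Type*} [MeasurableSpace Ω] {μ : Measure Ω}
    {σ : Type*} [Fintype σ] {E : σ → Type*} [∀ p, MeasurableSpace (E p)] {ν : (p : σ) → Measure (E p)}
    {G : Ω → ℝ} (hG : Measurable G) (hG0 : ∀ ω, 0 ≤ G ω)
    {g : (p : σ) → E p → ℝ} (hg : ∀ p, Measurable (g p)) (hg0 : ∀ p x, 0 ≤ g p x) {c : ℝ} (hc : 0 ≤ c)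
    (hfinG : ∫⁻ ω, ENNReal.ofReal (G ω) ∂μ ≠ ∞)
    (h : ENNReal.ofReal c * ∏ p, ∫⁻ x, ENNReal.ofReal (g p x) ∂ν p ≤ ∫⁻ ω, ENNReal.ofReal (G ω) ∂μ) :
    c * ∏ p, ∫ x, g p x ∂ν p ≤ ∫ ω, G ω ∂μ := by
  have hlhs : c * ∏ p, ∫ x, g p x ∂ν p =
      (ENNReal.ofReal c * ∏ p, ∫⁻ x, ENNReal.ofReal (g p x) ∂ν p).toReal := by
    rw [ENNReal.toReal_mul, ENNReal.toReal_ofReal hc, ENNReal.toReal_prod]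
    congr 1
    exact Finset.prod_congr rfl fun p _ =>
      integral_eq_lintegral_of_nonneg_ae (Filter.Eventually.of_forall (hg0 p)) (hg p).aestronglyMeasurable
  rw [integral_eq_lintegral_of_nonneg_ae (Filter.Eventually.of_forall hG0) hG.aestronglyMeasurable, hlhs]
  exact ENNReal.toReal_mono hfinG h

/-- kernel: the `∫⁻` of a bounded non-negative product observable is finite as soon as it is dominated by a constant times a product of
`∫⁻`s of bounded observables over probability measures. [folklore] -/
private theorem lintegral_ne_top_of_le_mul_prod {Ω : Type*} [MeasurableSpace Ω] {μ : Measure Ω}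
    {σ : Type*} [Fintype σ] {E : σ → Type*} [∀ p, MeasurableSpace (E p)] {ν : (p : σ) → Measure (E p)}
    [∀ p, IsProbabilityMeasure (ν p)] {G : Ω → ℝ≥0∞} {g : (p : σ) → E p → ℝ} {M : σ → ℝ}
    (hgM : ∀ p x, g p x ≤ M p) {c : ℝ}
    (h : ∫⁻ ω, G ω ∂μ ≤ ENNReal.ofReal c * ∏ p, ∫⁻ x, ENNReal.ofReal (g p x) ∂ν p) :
    ∫⁻ ω, G ω ∂μ ≠ ∞ := by
  have hfin : ∀ p, ∫⁻ x, ENNReal.ofReal (g p x) ∂ν p ≠ ∞ := fun p => by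
    refine ne_top_of_le_ne_top (ENNReal.ofReal_ne_top (r := M p)) ?_
    calc ∫⁻ x, ENNReal.ofReal (g p x) ∂ν p ≤ ∫⁻ _, ENNReal.ofReal (M p) ∂ν p :=
          lintegral_mono fun x => ENNReal.ofReal_le_ofReal (hgM p x)
      _ = ENNReal.ofReal (M p) := by rw [lintegral_const, measure_univ, mul_one]
  exact ne_top_of_le_ne_top
    (ENNReal.mul_ne_top ENNReal.ofReal_ne_top (ENNReal.prod_ne_top fun p _ => hfin p)) h

end Conversion

/-! ## §1  The class (5.13) in the Bochner currency: temperatures `∓diag r` -/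

section ClassFactorisation

variable {Λ : Finset (B1Eq324BenfattoLemma.Site d)} {A : Matrix Λ Λ ℝ}
  {K : B1Eq324BenfattoLemma.Site d → B1Eq324BenfattoLemma.Site d → ℝ}
  (hK : ∀ x y, K x y = if h : x ∈ Λ ∧ y ∈ Λ then (A⁻¹ : Matrix Λ Λ ℝ) ⟨x, h.1⟩ ⟨y, h.2⟩ else 0)

/-- kernel: the product of the box observables read on a configuration is measurable. [folklore] -/
private theorem measurable_prod_restrict {σ : Type*} [Fintype σ] (box : σ → Finset (B1Eq324BenfattoLemma.Site d))
    {F : (p : σ) → (↥(box p) → ℝ) → ℝ} (hF : ∀ p, Measurable (F p)) :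
    Measurable fun z : B1Eq324BenfattoLemma.Site d → ℝ => ∏ p, F p ((box p).restrict z) :=
  Finset.measurable_prod (f := fun p (z : B1Eq324BenfattoLemma.Site d → ℝ) => F p ((box p).restrict z)) Finset.univ
    fun p _ => (hF p).comp (Finset.measurable_restrict (box p))

/-- kernel: a box observable read on `EuclideanSpace` through `ofLp` is measurable. [folklore] -/
private theorem measurable_comp_ofLp {I : Finset (B1Eq324BenfattoLemma.Site d)} {F : (↥I → ℝ) → ℝ} (hF : Measurable F) :
    Measurable fun y : EuclideanSpace ℝ ↥I => F (ofLp y) :=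
  hF.comp (MeasurableEquiv.toLp 2 (↥I → ℝ)).symm.measurable

/-- kernel: `ofReal` of the product observable is the product of the `ofReal` observables. [folklore] -/
private theorem ofReal_prod_restrict {σ : Type*} [Fintype σ] (box : σ → Finset (B1Eq324BenfattoLemma.Site d))
    {F : (p : σ) → (↥(box p) → ℝ) → ℝ} (hF0 : ∀ p v, 0 ≤ F p v) (z : B1Eq324BenfattoLemma.Site d → ℝ) :
    ENNReal.ofReal (∏ p, F p ((box p).restrict z)) = ∏ p, ENNReal.ofReal (F p ((box p).restrict z)) :=
  ENNReal.ofReal_prod_of_nonneg fun p _ => hF0 p _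

include hK

/-- **THE CLASS (5.13) IN THE BOCHNER CURRENCY, upper** — «the integral factorizes over the boxes» at an exponentially decaying precision,
for bounded non-negative REAL observables.  Setting: the class kernel `K` of a symmetric `γ`-coercive precision `A` on `Λ`; corridors
`Γ ⊆ Λ`; a partition `π` of `↥(Λ ∖ Γ)` whose parts are given as `Q₀`-windows `box p = {y ∈ Λ ∖ Γ : π y = p}`; cross-row-sum bounds
`Σ_{π y′ ≠ π y}|A_{yy′}| ≤ r_y ≤ r_max < γ`; `ρ := (Σ_y r_y)/(γ − r_max)`.  Then for measurable `F_p` of the box fields with `0 ≤ F_p ≤ M_p`,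
`∫ Π_p F_p(z|_{box p}) dP̄^K_{Γ,z̄} ≤ e^{ρ} · Π_p ∫ F_p dN(u_Γ(z̄)|_{box p}, (A|_{box p} − diag(r|_{box p}))⁻¹)` — the `∫⁻` theorem
`…KernelComparisonBoxes.lintegral_prod_restrict_condFieldK_le_exp_mul_prod` read through `ofReal`/`toReal` (the box Gaussians are probability
measures, so bounded observables have finite `∫⁻`).  The free-field statement it replaces for a class consumer is
`…Sect5Eq515.integral_boxes_factorise_eq` (exact Markov property, (5.13) as printed, Bochner currency).
[cite: BenfattoEtAl1978, §5 (5.13) p.155, (5.36) p.159, p.153 «factorize “over the boxes □”» (class substitute, Bochner currency; ours)] -/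
theorem integral_prod_restrict_condFieldK_le_exp_mul_prod {σ : Type*} [Fintype σ] [DecidableEq σ]
    (hAs : ∀ e e', A e e' = A e' e) {γ rmax : ℝ} (hγ0 : 0 < γ)
    (hγ : ∀ x : Λ → ℝ, γ * ∑ e, x e ^ 2 ≤ ∑ e, ∑ e', A e e' * x e * x e')
    {Γ : Finset (B1Eq324BenfattoLemma.Site d)} (hΓ : Γ ⊆ Λ) (π : ↥(Λ \ Γ) → σ) (r : ↥(Λ \ Γ) → ℝ)
    (hr : ∀ y : ↥(Λ \ Γ), ∑ y' : ↥(Λ \ Γ), (if π y = π y' then (0 : ℝ) else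
      |A ⟨y, (Finset.mem_sdiff.mp y.2).1⟩ ⟨y', (Finset.mem_sdiff.mp y'.2).1⟩|) ≤ r y)
    (hrmax : ∀ y, r y ≤ rmax) (hγr : rmax < γ) (zbar : B1Eq324BenfattoLemma.Site d → ℝ)
    (box : σ → Finset (B1Eq324BenfattoLemma.Site d)) (hboxsub : ∀ p, box p ⊆ Λ \ Γ)
    (hbox : ∀ p (y : ↥(Λ \ Γ)), (y : B1Eq324BenfattoLemma.Site d) ∈ box p ↔ π y = p)
    {F : (p : σ) → (↥(box p) → ℝ) → ℝ} (hF : ∀ p, Measurable (F p)) (hF0 : ∀ p v, 0 ≤ F p v)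
    {M : σ → ℝ} (hFM : ∀ p v, F p v ≤ M p) :
    ∫ z, ∏ p, F p ((box p).restrict z) ∂((gaussianFieldOfKernel (condCov K Γ)).map
        fun (ζ : B1Eq324BenfattoLemma.Site d → ℝ) (x : B1Eq324BenfattoLemma.Site d) => condMean K Γ zbar x + ζ x) ≤
      Real.exp ((∑ y, r y) / (γ - rmax)) *
        ∏ p, ∫ y, F p (ofLp y) ∂multivariateGaussian (toLp 2 ((box p).restrict (condMean K Γ zbar)))
          (A.submatrix (fun j : ↥(box p) => (⟨j, (Finset.mem_sdiff.mp (hboxsub p j.2)).1⟩ : Λ))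
              (fun j : ↥(box p) => (⟨j, (Finset.mem_sdiff.mp (hboxsub p j.2)).1⟩ : Λ)) -
            Matrix.diagonal (fun j : ↥(box p) => r ⟨j, hboxsub p j.2⟩))⁻¹ := by
  have h := lintegral_prod_restrict_condFieldK_le_exp_mul_prod hK hAs hγ0 hγ hΓ π r hr hrmax hγr zbar box hboxsub hbox
    (F := fun p v => ENNReal.ofReal (F p v)) fun p => ENNReal.measurable_ofReal.comp (hF p)
  simp only [← ofReal_prod_restrict box hF0] at h
  exact integral_le_mul_prod_integral_of_lintegral (measurable_prod_restrict box hF)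
    (fun z => Finset.prod_nonneg fun p _ => hF0 p _) (fun p => measurable_comp_ofLp (hF p)) (fun p y => hF0 p _)
    (fun p y => hFM p _) (Real.exp_nonneg _) h

/-- **THE CLASS (5.13) IN THE BOCHNER CURRENCY, lower**: with the same data,
`e^{−ρ} · Π_p ∫ F_p dN(u_Γ(z̄)|_{box p}, (A|_{box p} + diag(r|_{box p}))⁻¹) ≤ ∫ Π_p F_p(z|_{box p}) dP̄^K_{Γ,z̄}` — the `∫⁻` theorem
`…KernelComparisonBoxes.exp_mul_prod_lintegral_le_lintegral_prod_restrict_condFieldK`, the finiteness of the right-hand side being read off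
the UPPER bound. [cite: BenfattoEtAl1978, §5 (5.13) p.155, (5.15) p.155 (class substitute, Bochner currency; ours)] -/
theorem exp_mul_prod_integral_le_integral_prod_restrict_condFieldK {σ : Type*} [Fintype σ] [DecidableEq σ]
    (hAs : ∀ e e', A e e' = A e' e) {γ rmax : ℝ} (hγ0 : 0 < γ)
    (hγ : ∀ x : Λ → ℝ, γ * ∑ e, x e ^ 2 ≤ ∑ e, ∑ e', A e e' * x e * x e')
    {Γ : Finset (B1Eq324BenfattoLemma.Site d)} (hΓ : Γ ⊆ Λ) (π : ↥(Λ \ Γ) → σ) (r : ↥(Λ \ Γ) → ℝ)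
    (hr : ∀ y : ↥(Λ \ Γ), ∑ y' : ↥(Λ \ Γ), (if π y = π y' then (0 : ℝ) else
      |A ⟨y, (Finset.mem_sdiff.mp y.2).1⟩ ⟨y', (Finset.mem_sdiff.mp y'.2).1⟩|) ≤ r y)
    (hrmax : ∀ y, r y ≤ rmax) (hγr : rmax < γ) (zbar : B1Eq324BenfattoLemma.Site d → ℝ)
    (box : σ → Finset (B1Eq324BenfattoLemma.Site d)) (hboxsub : ∀ p, box p ⊆ Λ \ Γ)
    (hbox : ∀ p (y : ↥(Λ \ Γ)), (y : B1Eq324BenfattoLemma.Site d) ∈ box p ↔ π y = p)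
    {F : (p : σ) → (↥(box p) → ℝ) → ℝ} (hF : ∀ p, Measurable (F p)) (hF0 : ∀ p v, 0 ≤ F p v)
    {M : σ → ℝ} (hFM : ∀ p v, F p v ≤ M p) :
    Real.exp (-((∑ y, r y) / (γ - rmax))) *
        ∏ p, ∫ y, F p (ofLp y) ∂multivariateGaussian (toLp 2 ((box p).restrict (condMean K Γ zbar)))
          (A.submatrix (fun j : ↥(box p) => (⟨j, (Finset.mem_sdiff.mp (hboxsub p j.2)).1⟩ : Λ))
              (fun j : ↥(box p) => (⟨j, (Finset.mem_sdiff.mp (hboxsub p j.2)).1⟩ : Λ)) +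
            Matrix.diagonal (fun j : ↥(box p) => r ⟨j, hboxsub p j.2⟩))⁻¹ ≤
      ∫ z, ∏ p, F p ((box p).restrict z) ∂((gaussianFieldOfKernel (condCov K Γ)).map
        fun (ζ : B1Eq324BenfattoLemma.Site d → ℝ) (x : B1Eq324BenfattoLemma.Site d) => condMean K Γ zbar x + ζ x) := by
  have hup := lintegral_prod_restrict_condFieldK_le_exp_mul_prod hK hAs hγ0 hγ hΓ π r hr hrmax hγr zbar box hboxsub hbox
    (F := fun p v => ENNReal.ofReal (F p v)) fun p => ENNReal.measurable_ofReal.comp (hF p)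
  have h := exp_mul_prod_lintegral_le_lintegral_prod_restrict_condFieldK hK hAs hγ0 hγ hΓ π r hr hrmax hγr zbar box hboxsub
    hbox (F := fun p v => ENNReal.ofReal (F p v)) fun p => ENNReal.measurable_ofReal.comp (hF p)
  simp only [← ofReal_prod_restrict box hF0] at hup h
  exact mul_prod_integral_le_integral_of_lintegral (measurable_prod_restrict box hF)
    (fun z => Finset.prod_nonneg fun p _ => hF0 p _) (fun p => measurable_comp_ofLp (hF p)) (fun p y => hF0 p _)
    (Real.exp_nonneg _) (lintegral_ne_top_of_le_mul_prod (fun p y => hFM p (ofLp y)) hup) h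

end ClassFactorisation

/-! ## §2  The class (5.13) at temperature zero in the Bochner currency: the plain Dirichlet box Gaussians -/

section Boxes

variable {Λ : Finset (B1Eq324BenfattoLemma.Site d)} {A : Matrix Λ Λ ℝ}
  {K : B1Eq324BenfattoLemma.Site d → B1Eq324BenfattoLemma.Site d → ℝ}
  (hK : ∀ x y, K x y = if h : x ∈ Λ ∧ y ∈ Λ then (A⁻¹ : Matrix Λ Λ ℝ) ⟨x, h.1⟩ ⟨y, h.2⟩ else 0)

/-- kernel: the support condition of a non-negative real product observable passes to its `ofReal` edition. [folklore] -/
private theorem supp_ofReal {σ : Type*} (box : σ → Finset (B1Eq324BenfattoLemma.Site d))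
    {F : (p : σ) → (↥(box p) → ℝ) → ℝ} {P : (B1Eq324BenfattoLemma.Site d → ℝ) → Prop}
    (hsupp : ∀ z : B1Eq324BenfattoLemma.Site d → ℝ, (∀ p, F p ((box p).restrict z) ≠ 0) → P z) :
    ∀ z : B1Eq324BenfattoLemma.Site d → ℝ, (∀ p, ENNReal.ofReal (F p ((box p).restrict z)) ≠ 0) → P z :=
  fun z hz => hsupp z fun p h0 => hz p (by rw [h0, ENNReal.ofReal_zero])

include hK

/-- **THE CLASS (5.13) AT TEMPERATURE ZERO IN THE BOCHNER CURRENCY, upper.**  Setting of §1, and measurable box observables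
`0 ≤ F_p ≤ M_p` whose product is supported in the bounded-fluctuation region `Σ_y r_y (z_y − u_Γ(z̄)_y)² ≤ T`.  Then
`∫ Π_p F_p(z|_{box p}) dP̄^K_{Γ,z̄} ≤ e^{ρ+T/2} · Π_p ∫ F_p dN(u_Γ(z̄)|_{box p}, (A|_{box p})⁻¹)` — the `∫⁻` theorem
`…KernelComparisonBounded.lintegral_prod_restrict_condFieldK_le_exp_mul_prod_dirichlet` read through `ofReal`/`toReal`.
[cite: BenfattoEtAl1978, §5 (5.13) p.155, (5.36) p.159, p.153 «factorize “over the boxes □”» (class substitute at temperature zero, Bochner currency; ours)] -/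
theorem integral_prod_restrict_condFieldK_le_exp_mul_prod_dirichlet {σ : Type*} [Fintype σ] [DecidableEq σ]
    (hAs : ∀ e e', A e e' = A e' e) {γ rmax : ℝ} (hγ0 : 0 < γ)
    (hγ : ∀ x : Λ → ℝ, γ * ∑ e, x e ^ 2 ≤ ∑ e, ∑ e', A e e' * x e * x e')
    {Γ : Finset (B1Eq324BenfattoLemma.Site d)} (hΓ : Γ ⊆ Λ) (π : ↥(Λ \ Γ) → σ) (r : ↥(Λ \ Γ) → ℝ)
    (hr : ∀ y : ↥(Λ \ Γ), ∑ y' : ↥(Λ \ Γ), (if π y = π y' then (0 : ℝ) else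
      |A ⟨y, (Finset.mem_sdiff.mp y.2).1⟩ ⟨y', (Finset.mem_sdiff.mp y'.2).1⟩|) ≤ r y)
    (hrmax : ∀ y, r y ≤ rmax) (hγr : rmax < γ) (zbar : B1Eq324BenfattoLemma.Site d → ℝ)
    (box : σ → Finset (B1Eq324BenfattoLemma.Site d)) (hboxsub : ∀ p, box p ⊆ Λ \ Γ)
    (hbox : ∀ p (y : ↥(Λ \ Γ)), (y : B1Eq324BenfattoLemma.Site d) ∈ box p ↔ π y = p)
    {F : (p : σ) → (↥(box p) → ℝ) → ℝ} (hF : ∀ p, Measurable (F p)) (hF0 : ∀ p v, 0 ≤ F p v)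
    {M : σ → ℝ} (hFM : ∀ p v, F p v ≤ M p) {T : ℝ}
    (hsupp : ∀ z : B1Eq324BenfattoLemma.Site d → ℝ, (∀ p, F p ((box p).restrict z) ≠ 0) →
      ∑ y : ↥(Λ \ Γ), r y * (z y - condMean K Γ zbar y) ^ 2 ≤ T) :
    ∫ z, ∏ p, F p ((box p).restrict z) ∂((gaussianFieldOfKernel (condCov K Γ)).map
        fun (ζ : B1Eq324BenfattoLemma.Site d → ℝ) (x : B1Eq324BenfattoLemma.Site d) => condMean K Γ zbar x + ζ x) ≤
      Real.exp ((∑ y, r y) / (γ - rmax) + T / 2) *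
        ∏ p, ∫ y, F p (ofLp y) ∂multivariateGaussian (toLp 2 ((box p).restrict (condMean K Γ zbar)))
          (A.submatrix (fun j : ↥(box p) => (⟨j, (Finset.mem_sdiff.mp (hboxsub p j.2)).1⟩ : Λ))
              (fun j : ↥(box p) => (⟨j, (Finset.mem_sdiff.mp (hboxsub p j.2)).1⟩ : Λ)))⁻¹ := by
  have h := lintegral_prod_restrict_condFieldK_le_exp_mul_prod_dirichlet hK hAs hγ0 hγ hΓ π r hr hrmax hγr zbar box hboxsub
    hbox (F := fun p v => ENNReal.ofReal (F p v)) (fun p => ENNReal.measurable_ofReal.comp (hF p)) (supp_ofReal box hsupp)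
  simp only [← ofReal_prod_restrict box hF0] at h
  exact integral_le_mul_prod_integral_of_lintegral (measurable_prod_restrict box hF)
    (fun z => Finset.prod_nonneg fun p _ => hF0 p _) (fun p => measurable_comp_ofLp (hF p)) (fun p y => hF0 p _)
    (fun p y => hFM p _) (Real.exp_nonneg _) h

/-- **THE CLASS (5.13) AT TEMPERATURE ZERO IN THE BOCHNER CURRENCY, lower**: with the same data and the same support condition,
`e^{−(ρ+T/2)} · Π_p ∫ F_p dN(u_Γ(z̄)|_{box p}, (A|_{box p})⁻¹) ≤ ∫ Π_p F_p(z|_{box p}) dP̄^K_{Γ,z̄}` — the SAME product measure as in the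
upper bound, so that a pavement step written in the Bochner currency can go down and come back up through one family of box Gaussians
(`…KernelComparisonBounded.exp_mul_prod_dirichlet_le_lintegral_prod_restrict_condFieldK` read through `ofReal`/`toReal`, the finiteness of
the right-hand side being read off the upper bound).
[cite: BenfattoEtAl1978, §5 (5.13) p.155, (5.15) p.155 (class substitute at temperature zero, Bochner currency; ours)] -/
theorem exp_mul_prod_dirichlet_le_integral_prod_restrict_condFieldK {σ : Type*} [Fintype σ] [DecidableEq σ]
    (hAs : ∀ e e', A e e' = A e' e) {γ rmax : ℝ} (hγ0 : 0 < γ)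
    (hγ : ∀ x : Λ → ℝ, γ * ∑ e, x e ^ 2 ≤ ∑ e, ∑ e', A e e' * x e * x e')
    {Γ : Finset (B1Eq324BenfattoLemma.Site d)} (hΓ : Γ ⊆ Λ) (π : ↥(Λ \ Γ) → σ) (r : ↥(Λ \ Γ) → ℝ)
    (hr : ∀ y : ↥(Λ \ Γ), ∑ y' : ↥(Λ \ Γ), (if π y = π y' then (0 : ℝ) else
      |A ⟨y, (Finset.mem_sdiff.mp y.2).1⟩ ⟨y', (Finset.mem_sdiff.mp y'.2).1⟩|) ≤ r y)
    (hrmax : ∀ y, r y ≤ rmax) (hγr : rmax < γ) (zbar : B1Eq324BenfattoLemma.Site d → ℝ)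
    (box : σ → Finset (B1Eq324BenfattoLemma.Site d)) (hboxsub : ∀ p, box p ⊆ Λ \ Γ)
    (hbox : ∀ p (y : ↥(Λ \ Γ)), (y : B1Eq324BenfattoLemma.Site d) ∈ box p ↔ π y = p)
    {F : (p : σ) → (↥(box p) → ℝ) → ℝ} (hF : ∀ p, Measurable (F p)) (hF0 : ∀ p v, 0 ≤ F p v)
    {M : σ → ℝ} (hFM : ∀ p v, F p v ≤ M p) {T : ℝ}
    (hsupp : ∀ z : B1Eq324BenfattoLemma.Site d → ℝ, (∀ p, F p ((box p).restrict z) ≠ 0) →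
      ∑ y : ↥(Λ \ Γ), r y * (z y - condMean K Γ zbar y) ^ 2 ≤ T) :
    Real.exp (-((∑ y, r y) / (γ - rmax) + T / 2)) *
        ∏ p, ∫ y, F p (ofLp y) ∂multivariateGaussian (toLp 2 ((box p).restrict (condMean K Γ zbar)))
          (A.submatrix (fun j : ↥(box p) => (⟨j, (Finset.mem_sdiff.mp (hboxsub p j.2)).1⟩ : Λ))
              (fun j : ↥(box p) => (⟨j, (Finset.mem_sdiff.mp (hboxsub p j.2)).1⟩ : Λ)))⁻¹ ≤
      ∫ z, ∏ p, F p ((box p).restrict z) ∂((gaussianFieldOfKernel (condCov K Γ)).map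
        fun (ζ : B1Eq324BenfattoLemma.Site d → ℝ) (x : B1Eq324BenfattoLemma.Site d) => condMean K Γ zbar x + ζ x) := by
  have hup := lintegral_prod_restrict_condFieldK_le_exp_mul_prod_dirichlet hK hAs hγ0 hγ hΓ π r hr hrmax hγr zbar box hboxsub
    hbox (F := fun p v => ENNReal.ofReal (F p v)) (fun p => ENNReal.measurable_ofReal.comp (hF p)) (supp_ofReal box hsupp)
  have h := exp_mul_prod_dirichlet_le_lintegral_prod_restrict_condFieldK hK hAs hγ0 hγ hΓ π r hr hrmax hγr zbar box hboxsub
    hbox (F := fun p v => ENNReal.ofReal (F p v)) (fun p => ENNReal.measurable_ofReal.comp (hF p)) (supp_ofReal box hsupp)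
  simp only [← ofReal_prod_restrict box hF0] at hup h
  exact mul_prod_integral_le_integral_of_lintegral (measurable_prod_restrict box hF)
    (fun z => Finset.prod_nonneg fun p _ => hF0 p _) (fun p => measurable_comp_ofLp (hF p)) (fun p y => hF0 p _)
    (Real.exp_nonneg _) (lintegral_ne_top_of_le_mul_prod (fun p y => hFM p (ofLp y)) hup) h

end Boxes

end Literature.MathematicalPhysics.QuantumFieldTheory.Balaban1983to89.B1Eq324BenfattoKernelComparisonBochner
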